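import Mathlib
import HarnessLib

/-!
# Strip tests: smooth `1`-periodic functions supported in a horizontal strip, and their
Fourier coefficients along horizontal lines

Support file (all statements PROVED, no definitions, no named facts) for the elementary proof of
the unconditional rate `m_F(y) = c + O(y^{1/2})` of equidistribution of closed horocycles on
`SL(2,ℤ)\ℍ` (`Literature.NumberTheory.LFunctions.zagier_sarnak_horocycle_rate_half`,
`HorocycleEquidistribution.lean`; Sarnak 1981, Thm. 1; Zagier 1981, §1).

A *strip test* is `f : ℂ → ℂ` with `ContDiff ℝ ∞ f`, `f (z + 1) = f z`, and
`f z ≠ 0 → a ≤ im z ≤ b` for some `0 < a ≤ b` (these hypotheses are carried explicitly; the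
proof of the rate reduces a smooth compactly supported function on the modular surface to such an
`f` by a smooth partition of unity over `Γ_∞\Γ`, Iwaniec, *Spectral methods*, §3.2–§3.4). Here:

* the class is stable under the directional derivatives `z ↦ D f(z) v` (`contDiff_fderiv_apply`,
  `periodic_fderiv_apply`, `support_fderiv_apply`), strip tests are bounded (`exists_bound`),
  and vanish on the boundary lines of the strip (`im_mem_Ioo_of_ne_zero`);
* the Fourier coefficients along the horizontal line at height `h`,
  `g_k(h) = ∫₀¹ f(x + ih) e(-kx) dx`, satisfy the periodic integration-by-parts identity
  (`integral_mul_exp_eq_of_periodic`), hence `‖g_k(h)‖ ≤ C / |k|³` uniformly in `h`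
  (`exists_norm_coeff_le`), and `h ↦ g_k(h)` is differentiable with derivative the coefficient of
  `z ↦ D f(z) I` (`hasDerivAt_coeff`);
* a continuous `1`-periodic `Φ : ℝ → ℂ` with summable coefficients is the pointwise sum of its
  Fourier series (`hasSum_fourier_of_periodic`, from Mathlib's
  `has_pointwise_sum_fourier_series_of_summable` on `UnitAddCircle`), and coefficients bounded by
  `M/|k|³` are summable (`summable_of_norm_le_div_cube`).

## References
* H. Iwaniec, *Spectral Methods of Automorphic Forms*, 2nd ed., AMS GSM 53 (2002), §3.2–§3.4.
* P. Sarnak, *Asymptotic behavior of periodic orbits of the horocycle flow and Eisenstein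
  series*, Comm. Pure Appl. Math. 34 (1981), 719–739, Thm. 1.

## Mathlib search
`fourierCoeffOn_of_hasDerivAt`, `has_pointwise_sum_fourier_series_of_summable`,
`fourierCoeff_liftIco_eq`, `AddCircle.liftIco_zero_continuous`,
`intervalIntegral.hasDerivAt_integral_of_dominated_loc_of_deriv_le`, `fderiv_comp_add_right`.
No Mathlib notion of functions periodic in `re z` on `ℂ`; everything is phrased with explicit
hypotheses.
-/

noncomputable section

open Complex MeasureTheory Set Filter Topology intervalIntegral
open scoped Real ContDiff

namespace Literature.NumberTheory.LFunctions

namespace HorocycleStripFourier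

variable {f : ℂ → ℂ} {a b : ℝ}

/-! ### Support, periodicity, boundedness -/

/-- A continuous function supported in the closed strip `a ≤ im z ≤ b` is in fact supported in
the open strip (the set `{f ≠ 0}` is open). [folklore] -/
theorem im_mem_Ioo_of_ne_zero (hfc : Continuous f) (hsupp : ∀ z, f z ≠ 0 → a ≤ z.im ∧ z.im ≤ b)
    {z : ℂ} (hz : f z ≠ 0) : a < z.im ∧ z.im < b := by
  have hopen : IsOpen {w : ℂ | f w ≠ 0} := isOpen_ne_fun hfc continuous_const
  obtain ⟨ε, hε, hball⟩ := Metric.isOpen_iff.mp hopen z hz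
  have hn : ‖(((ε / 2 : ℝ) : ℂ) * I)‖ = ε / 2 := by
    rw [norm_mul, Complex.norm_I, mul_one, Complex.norm_real, Real.norm_eq_abs,
      abs_of_pos (half_pos hε)]
  constructor
  · have hmem : z - ((ε / 2 : ℝ) : ℂ) * I ∈ Metric.ball z ε := by
      rw [Metric.mem_ball, dist_eq_norm, sub_sub_cancel_left, norm_neg, hn]; linarith
    have h1 := (hsupp _ (hball hmem)).1
    simp only [sub_im, mul_im, ofReal_re, I_im, mul_one, ofReal_im, I_re, mul_zero, add_zero] at h1
    linarith
  · have hmem : z + ((ε / 2 : ℝ) : ℂ) * I ∈ Metric.ball z ε := by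
      rw [Metric.mem_ball, dist_eq_norm, add_sub_cancel_left, hn]; linarith
    have h1 := (hsupp _ (hball hmem)).2
    simp only [add_im, mul_im, ofReal_re, I_im, mul_one, ofReal_im, I_re, mul_zero, add_zero] at h1
    linarith

/-- `1`-periodicity gives `ℤ`-periodicity. [folklore] -/
theorem periodic_int (hper : ∀ z, f (z + 1) = f z) (z : ℂ) (n : ℤ) : f (z + n) = f z := by
  induction n using Int.induction_on with
  | zero => simp
  | succ n ih =>
    rw [show z + ((n + 1 : ℤ) : ℂ) = (z + ((n : ℤ) : ℂ)) + 1 by push_cast; ring, hper, ih]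
  | pred n ih =>
    have h := hper (z + ((-(n : ℤ) - 1 : ℤ) : ℂ))
    rw [show z + ((-(n : ℤ) - 1 : ℤ) : ℂ) + 1 = z + ((-(n : ℤ) : ℤ) : ℂ) by push_cast; ring] at h
    rw [h] at ih
    exact ih

/-- **Boundedness.** A continuous `1`-periodic function supported in a strip is bounded (it is
bounded on the compact period box `[0,1] × [a,b]`). [folklore] -/
theorem exists_bound (hfc : Continuous f) (hper : ∀ z, f (z + 1) = f z)
    (hsupp : ∀ z, f z ≠ 0 → a ≤ z.im ∧ z.im ≤ b) : ∃ C : ℝ, 0 ≤ C ∧ ∀ z, ‖f z‖ ≤ C := by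
  set K : Set ℂ := (fun p : ℝ × ℝ => (p.1 : ℂ) + (p.2 : ℂ) * I) '' (Icc (0 : ℝ) 1 ×ˢ Icc a b)
    with hK_def
  have hK : IsCompact K := (isCompact_Icc.prod isCompact_Icc).image (by fun_prop)
  obtain ⟨C, hC⟩ := hK.exists_bound_of_continuousOn hfc.continuousOn
  refine ⟨max C 0, le_max_right _ _, fun z => ?_⟩
  by_cases hz : f z = 0
  · rw [hz, norm_zero]; exact le_max_right _ _
  obtain ⟨h1, h2⟩ := hsupp z hz
  have hmem : z + ((-⌊z.re⌋ : ℤ) : ℂ) ∈ K := by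
    refine ⟨(z.re - ⌊z.re⌋, z.im), ⟨⟨?_, ?_⟩, h1, h2⟩, ?_⟩
    · linarith [Int.floor_le z.re]
    · linarith [Int.lt_floor_add_one z.re]
    · apply Complex.ext <;> simp
      rw [Int.fract]; ring
  calc ‖f z‖ = ‖f (z + ((-⌊z.re⌋ : ℤ) : ℂ))‖ := by rw [periodic_int hper]
    _ ≤ C := hC _ hmem
    _ ≤ max C 0 := le_max_left _ _

/-- Outside the open strip a strip-supported function vanishes identically near the point, so
all its derivatives vanish there. [folklore] -/
theorem eventuallyEq_zero_of_not_mem (hsupp : ∀ z, f z ≠ 0 → a ≤ z.im ∧ z.im ≤ b) {z : ℂ}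
    (hz : ¬(a ≤ z.im ∧ z.im ≤ b)) : f =ᶠ[𝓝 z] fun _ => 0 := by
  rw [not_and_or, not_le, not_le] at hz
  rcases hz with h | h
  · have : {w : ℂ | w.im < a} ∈ 𝓝 z := (isOpen_lt continuous_im continuous_const).mem_nhds h
    filter_upwards [this] with w hw
    by_contra hw'
    exact absurd (hsupp w hw').1 (not_le.mpr hw)
  · have : {w : ℂ | b < w.im} ∈ 𝓝 z := (isOpen_lt continuous_const continuous_im).mem_nhds h
    filter_upwards [this] with w hw
    by_contra hw'
    exact absurd (hsupp w hw').2 (not_le.mpr hw)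

/-! ### Directional derivatives `z ↦ D f(z) v` stay in the class -/

/-- Smoothness of `z ↦ D f(z) v`. [folklore] -/
theorem contDiff_fderiv_apply (hf : ContDiff ℝ ∞ f) (v : ℂ) :
    ContDiff ℝ ∞ fun z => fderiv ℝ f z v :=
  (hf.fderiv_right (m := ∞) le_rfl).clm_apply contDiff_const

/-- Periodicity of `z ↦ D f(z) v`. [folklore] -/
theorem periodic_fderiv_apply (hper : ∀ z, f (z + 1) = f z) (v : ℂ) (z : ℂ) :
    fderiv ℝ f (z + 1) v = fderiv ℝ f z v := by
  rw [← fderiv_comp_add_right, show (fun w => f (w + 1)) = f from funext hper]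

/-- Strip support of `z ↦ D f(z) v`. [folklore] -/
theorem support_fderiv_apply (hsupp : ∀ z, f z ≠ 0 → a ≤ z.im ∧ z.im ≤ b) (v : ℂ) (z : ℂ)
    (hz : fderiv ℝ f z v ≠ 0) : a ≤ z.im ∧ z.im ≤ b := by
  by_contra hcon
  have h0 : fderiv ℝ f z = 0 := by
    rw [(eventuallyEq_zero_of_not_mem hsupp hcon).fderiv_eq]; simp
  exact hz (by simp [h0])

/-- Chain rule along the horizontal line at height `h`. [folklore] -/
theorem hasDerivAt_horizontal (hf : ContDiff ℝ ∞ f) (h x : ℝ) :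
    HasDerivAt (fun x : ℝ => f (x + h * I)) (fderiv ℝ f (x + h * I) 1) x := by
  have h1 : HasDerivAt (fun x : ℝ => (x : ℂ) + h * I) 1 x := by
    simpa using (hasDerivAt_id x).ofReal_comp.add_const ((h : ℂ) * I)
  have h2 : HasFDerivAt f (fderiv ℝ f (x + h * I)) (x + h * I) :=
    ((hf.differentiable (by simp)) _).hasFDerivAt
  exact h2.comp_hasDerivAt x h1

/-- Chain rule along the vertical line through `x`. [folklore] -/
theorem hasDerivAt_vertical (hf : ContDiff ℝ ∞ f) (x h : ℝ) :
    HasDerivAt (fun h : ℝ => f (x + h * I)) (fderiv ℝ f (x + h * I) I) h := by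
  have h1 : HasDerivAt (fun h : ℝ => (x : ℂ) + h * I) I h := by
    simpa using ((hasDerivAt_id h).ofReal_comp.mul_const I).const_add (x : ℂ)
  have h2 : HasFDerivAt f (fderiv ℝ f (x + h * I)) (x + h * I) :=
    ((hf.differentiable (by simp)) _).hasFDerivAt
  exact h2.comp_hasDerivAt h h1


/-! ### Fourier coefficients along horizontal lines -/

/-- The additive character has norm one. [folklore] -/
theorem norm_exp_neg_two_pi_mul (k : ℤ) (x : ℝ) : ‖Complex.exp (-(2 * π * I * k * x))‖ = 1 := by
  rw [Complex.norm_exp]; simp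

/-- **Periodic integration by parts**: for `φ` of class `C¹` with `φ 1 = φ 0` and `k ≠ 0`,
`∫₀¹ φ e(-kx) dx = (2πik)⁻¹ ∫₀¹ φ' e(-kx) dx`. [folklore] -/
theorem integral_mul_exp_eq_of_periodic {φ φ' : ℝ → ℂ} (hφ : ∀ x, HasDerivAt φ (φ' x) x)
    (hφ'c : Continuous φ') (hφp : φ 1 = φ 0) {k : ℤ} (hk : k ≠ 0) :
    ∫ x in (0:ℝ)..1, φ x * Complex.exp (-(2 * π * I * k * x)) =
      (1 / (2 * π * I * k)) * ∫ x in (0:ℝ)..1, φ' x * Complex.exp (-(2 * π * I * k * x)) := by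
  set c : ℂ := 2 * π * I * k with hc_def
  have hc : c ≠ 0 := by
    simp [hc_def, Real.pi_ne_zero, I_ne_zero, hk]
  have hv : ∀ x : ℝ, HasDerivAt (fun x : ℝ => Complex.exp (-(c * x)) / (-c))
      (Complex.exp (-(c * x))) x := by
    intro x
    have h1 : HasDerivAt (fun x : ℝ => -(c * x)) (-c) x := by
      simpa [neg_mul] using (hasDerivAt_id x).ofReal_comp.const_mul (-c)
    exact (h1.cexp.div_const (-c)).congr_deriv (mul_div_cancel_right₀ _ (neg_ne_zero.mpr hc))
  have hi := intervalIntegral.integral_mul_deriv_eq_deriv_mul (a := (0:ℝ)) (b := 1) (u := φ)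
    (u' := φ') (fun x _ => hφ x) (fun x _ => hv x) (hφ'c.intervalIntegrable _ _)
    (Continuous.intervalIntegrable (by fun_prop) _ _)
  rw [hi]
  have e1 : Complex.exp (-(c * ((1:ℝ) : ℂ))) = 1 := by
    rw [Complex.exp_eq_one_iff]; exact ⟨-k, by rw [hc_def]; push_cast; ring⟩
  have e0 : Complex.exp (-(c * ((0:ℝ) : ℂ))) = 1 := by simp
  rw [e1, e0, hφp]
  have e2 : ∫ x in (0:ℝ)..1, φ' x * (Complex.exp (-(c * x)) / -c) =
      (∫ x in (0:ℝ)..1, φ' x * Complex.exp (-(c * x))) / -c := by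
    rw [← intervalIntegral.integral_div]; congr 1; ext x; ring
  rw [e2]
  field_simp
  ring

/-- Outside `[a, b]` the coefficients vanish (`f(x + ih) = 0`). [folklore] -/
theorem coeff_eq_zero_of_not_mem (hsupp : ∀ z, f z ≠ 0 → a ≤ z.im ∧ z.im ≤ b) {h : ℝ}
    (hh : h < a ∨ b < h) (k : ℤ) :
    ∫ x in (0:ℝ)..1, f (x + h * I) * Complex.exp (-(2 * π * I * k * x)) = 0 := by
  have h0 : ∀ x : ℝ, f (x + h * I) = 0 := fun x => by
    by_contra hne
    have := hsupp _ hne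
    simp only [add_im, ofReal_im, mul_im, ofReal_re, I_im, mul_one, I_re, mul_zero, add_zero,
      zero_add] at this
    rcases hh with hh | hh <;> linarith [this.1, this.2]
  simp [h0]

/-- The endpoint values of `x ↦ g(x + ih)` agree for a `1`-periodic `g`. [folklore] -/
theorem apply_one_add_eq (g : ℂ → ℂ) (hgp : ∀ z, g (z + 1) = g z) (h : ℝ) :
    g ((1:ℝ) + h * I) = g ((0:ℝ) + h * I) := by
  calc g ((1:ℝ) + h * I) = g (((0:ℝ) + h * I) + 1) := by congr 1; push_cast; ring
    _ = g ((0:ℝ) + h * I) := hgp _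

/-- One integration by parts for the coefficients of a smooth periodic `g` along a horizontal
line: the derivative is the coefficient of `z ↦ D g(z) 1`. [folklore] -/
theorem coeff_eq_coeff_fderiv {g : ℂ → ℂ} (hg : ContDiff ℝ ∞ g) (hgp : ∀ z, g (z + 1) = g z)
    (h : ℝ) {k : ℤ} (hk : k ≠ 0) :
    ∫ x in (0:ℝ)..1, g (x + h * I) * Complex.exp (-(2 * π * I * k * x)) =
      (1 / (2 * π * I * k)) *
        ∫ x in (0:ℝ)..1, fderiv ℝ g (x + h * I) 1 * Complex.exp (-(2 * π * I * k * x)) := by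
  have hc : Continuous fun x : ℝ => fderiv ℝ g (x + h * I) 1 :=
    (contDiff_fderiv_apply hg 1).continuous.comp (by fun_prop)
  exact integral_mul_exp_eq_of_periodic (fun x => hasDerivAt_horizontal hg h x) hc
    (apply_one_add_eq g hgp h) hk

/-- **Decay of the coefficients**, uniformly in the height: for a strip test `f` there is `C`
with `‖∫₀¹ f(x+ih) e(-kx) dx‖ ≤ C / |k|³` for all `h` and all `k ≠ 0` (three integrations by
parts; `C` bounds `∂ₓ³ f`). [folklore] -/
theorem exists_norm_coeff_le (hf : ContDiff ℝ ∞ f) (hper : ∀ z, f (z + 1) = f z)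
    (hsupp : ∀ z, f z ≠ 0 → a ≤ z.im ∧ z.im ≤ b) :
    ∃ C : ℝ, 0 ≤ C ∧ ∀ (h : ℝ) (k : ℤ), k ≠ 0 →
      ‖∫ x in (0:ℝ)..1, f (x + h * I) * Complex.exp (-(2 * π * I * k * x))‖ ≤
        C / |(k : ℝ)| ^ 3 := by
  set f₁ : ℂ → ℂ := fun z => fderiv ℝ f z 1 with hf₁_def
  set f₂ : ℂ → ℂ := fun z => fderiv ℝ f₁ z 1 with hf₂_def
  set f₃ : ℂ → ℂ := fun z => fderiv ℝ f₂ z 1 with hf₃_def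
  have hf₁ : ContDiff ℝ ∞ f₁ := contDiff_fderiv_apply hf 1
  have hf₂ : ContDiff ℝ ∞ f₂ := contDiff_fderiv_apply hf₁ 1
  have hf₃ : ContDiff ℝ ∞ f₃ := contDiff_fderiv_apply hf₂ 1
  have hp₁ : ∀ z, f₁ (z + 1) = f₁ z := periodic_fderiv_apply hper 1
  have hp₂ : ∀ z, f₂ (z + 1) = f₂ z := periodic_fderiv_apply hp₁ 1
  have hp₃ : ∀ z, f₃ (z + 1) = f₃ z := periodic_fderiv_apply hp₂ 1
  have hs₁ : ∀ z, f₁ z ≠ 0 → a ≤ z.im ∧ z.im ≤ b := support_fderiv_apply hsupp 1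
  have hs₂ : ∀ z, f₂ z ≠ 0 → a ≤ z.im ∧ z.im ≤ b := support_fderiv_apply hs₁ 1
  have hs₃ : ∀ z, f₃ z ≠ 0 → a ≤ z.im ∧ z.im ≤ b := support_fderiv_apply hs₂ 1
  obtain ⟨C, hC0, hC⟩ := exists_bound hf₃.continuous hp₃ hs₃
  refine ⟨C, hC0, fun h k hk => ?_⟩
  rw [coeff_eq_coeff_fderiv hf hper h hk, coeff_eq_coeff_fderiv hf₁ hp₁ h hk,
    coeff_eq_coeff_fderiv hf₂ hp₂ h hk]
  change ‖(1 / (2 * π * I * k)) * ((1 / (2 * π * I * k)) * ((1 / (2 * π * I * k)) *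
    ∫ x in (0:ℝ)..1, f₃ (x + h * I) * Complex.exp (-(2 * π * I * k * x))))‖ ≤ C / |(k : ℝ)| ^ 3
  have hI3 : ‖∫ x in (0:ℝ)..1, f₃ (x + h * I) * Complex.exp (-(2 * π * I * k * x))‖ ≤ C := by
    have := intervalIntegral.norm_integral_le_of_norm_le_const (a := (0:ℝ)) (b := 1) (C := C)
      (f := fun x => f₃ (x + h * I) * Complex.exp (-(2 * π * I * k * x))) (fun x _ => by
        rw [norm_mul, norm_exp_neg_two_pi_mul, mul_one]; exact hC _)
    simpa using this
  have hk' : (0:ℝ) < |(k : ℝ)| := abs_pos.mpr (Int.cast_ne_zero.mpr hk)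
  have hc : ‖(1 / (2 * π * I * k) : ℂ)‖ ≤ 1 / |(k : ℝ)| := by
    have e : ‖(1 / (2 * π * I * k) : ℂ)‖ = 1 / (2 * π * |(k : ℝ)|) := by
      simp [abs_of_pos Real.pi_pos]
    rw [e, div_le_div_iff₀ (by positivity) hk', one_mul, one_mul]
    nlinarith [Real.pi_gt_three]
  rw [norm_mul, norm_mul, norm_mul]
  calc ‖(1 / (2 * π * I * k) : ℂ)‖ * (‖(1 / (2 * π * I * k) : ℂ)‖ * (‖(1 / (2 * π * I * k) : ℂ)‖ *
      ‖∫ x in (0:ℝ)..1, f₃ (x + h * I) * Complex.exp (-(2 * π * I * k * x))‖))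
      ≤ (1 / |(k : ℝ)|) * ((1 / |(k : ℝ)|) * ((1 / |(k : ℝ)|) * C)) := by
        gcongr
    _ = C / |(k : ℝ)| ^ 3 := by field_simp

/-- **Differentiation in the height**: `h ↦ ∫₀¹ f(x+ih) e(-kx) dx` has derivative the
corresponding coefficient of `z ↦ D f(z) I` (differentiation under the integral sign, the
integrand being dominated by a bound for `D f · I`). [folklore] -/
theorem hasDerivAt_coeff (hf : ContDiff ℝ ∞ f) (hper : ∀ z, f (z + 1) = f z)
    (hsupp : ∀ z, f z ≠ 0 → a ≤ z.im ∧ z.im ≤ b) (k : ℤ) (h₀ : ℝ) :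
    HasDerivAt (fun h : ℝ => ∫ x in (0:ℝ)..1, f (x + h * I) * Complex.exp (-(2 * π * I * k * x)))
      (∫ x in (0:ℝ)..1, fderiv ℝ f (x + h₀ * I) I * Complex.exp (-(2 * π * I * k * x))) h₀ := by
  have hfc : Continuous f := hf.continuous
  have hfIc : Continuous fun z => fderiv ℝ f z I := (contDiff_fderiv_apply hf I).continuous
  obtain ⟨C, -, hC⟩ := exists_bound hfIc (periodic_fderiv_apply hper I)
    (support_fderiv_apply hsupp I)
  refine (intervalIntegral.hasDerivAt_integral_of_dominated_loc_of_deriv_le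
    (𝕜 := ℝ) (μ := volume) (a := (0:ℝ)) (b := 1) (x₀ := h₀) (s := univ)
    (F := fun (h : ℝ) (x : ℝ) => f (x + h * I) * Complex.exp (-(2 * π * I * k * x)))
    (F' := fun (h : ℝ) (x : ℝ) => fderiv ℝ f (x + h * I) I * Complex.exp (-(2 * π * I * k * x)))
    (bound := fun _ => C) univ_mem ?_ ?_ ?_ ?_ ?_ ?_).2
  · exact Eventually.of_forall fun h =>
      (Continuous.aestronglyMeasurable (by fun_prop))
  · exact Continuous.intervalIntegrable (by fun_prop) _ _
  · exact Continuous.aestronglyMeasurable (hfIc.comp (by fun_prop) |>.mul (by fun_prop))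
  · exact ae_of_all _ fun x _ h _ => by
      rw [norm_mul, norm_exp_neg_two_pi_mul, mul_one]; exact hC _
  · exact intervalIntegrable_const
  · exact ae_of_all _ fun x _ h _ => (hasDerivAt_vertical hf x h).mul_const _

/-- Continuity in the height of the coefficients. [folklore] -/
theorem continuous_coeff (hf : ContDiff ℝ ∞ f) (hper : ∀ z, f (z + 1) = f z)
    (hsupp : ∀ z, f z ≠ 0 → a ≤ z.im ∧ z.im ≤ b) (k : ℤ) :
    Continuous fun h : ℝ => ∫ x in (0:ℝ)..1, f (x + h * I) * Complex.exp (-(2 * π * I * k * x)) :=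
  continuous_iff_continuousAt.2 fun h => (hasDerivAt_coeff hf hper hsupp k h).continuousAt

/-! ### Pointwise convergence of the Fourier series of a periodic function -/

/-- Coefficients bounded by `M/|k|³` off `0` are summable. [folklore] -/
theorem summable_of_norm_le_div_cube {c : ℤ → ℂ} {M : ℝ}
    (hM : ∀ k : ℤ, k ≠ 0 → ‖c k‖ ≤ M / |(k : ℝ)| ^ 3) : Summable c := by
  have hs : Summable fun k : ℤ => M * |1 / (k : ℝ) ^ 3| :=
    ((Real.summable_one_div_int_pow.mpr (by norm_num)).abs).mul_left M
  refine Summable.of_norm_bounded_eventually hs ?_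
  filter_upwards [eventually_cofinite_ne (0 : ℤ)] with k hk
  rw [abs_div, abs_one, abs_pow]
  calc ‖c k‖ ≤ M / |(k : ℝ)| ^ 3 := hM k hk
    _ = M * (1 / |(k : ℝ)| ^ 3) := by ring

/-- **Pointwise Fourier expansion of a continuous `1`-periodic function with summable
coefficients**: `Φ θ = ∑_k (∫₀¹ Φ e(-k·)) e(kθ)` (Mathlib's
`has_pointwise_sum_fourier_series_of_summable` on `UnitAddCircle`, unwrapped). [folklore] -/
theorem hasSum_fourier_of_periodic {Φ : ℝ → ℂ} (hΦc : Continuous Φ) (hΦp : ∀ x, Φ (x + 1) = Φ x)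
    (hsum : Summable fun k : ℤ => ∫ x in (0:ℝ)..1, Φ x * Complex.exp (-(2 * π * I * k * x)))
    (θ : ℝ) :
    HasSum (fun k : ℤ => (∫ x in (0:ℝ)..1, Φ x * Complex.exp (-(2 * π * I * k * x))) *
      Complex.exp (2 * π * I * k * θ)) (Φ θ) := by
  let F : C(UnitAddCircle, ℂ) := ⟨AddCircle.liftIco 1 0 Φ,
    AddCircle.liftIco_zero_continuous (by simpa using (hΦp 0).symm) hΦc.continuousOn⟩
  have hcoef : ∀ k : ℤ, fourierCoeff F k =
      ∫ x in (0:ℝ)..1, Φ x * Complex.exp (-(2 * π * I * k * x)) := by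
    intro k
    rw [ContinuousMap.coe_mk, fourierCoeff_liftIco_eq, fourierCoeffOn_eq_integral]
    simp only [zero_add, sub_zero, div_one, one_smul]
    refine intervalIntegral.integral_congr fun x _ => ?_
    rw [fourier_coe_apply, smul_eq_mul, mul_comm]
    congr 1
    push_cast
    ring_nf
  have hsum' : Summable (fourierCoeff F) := hsum.congr fun k => (hcoef k).symm
  have hper : Function.Periodic Φ 1 := hΦp
  have step := has_pointwise_sum_fourier_series_of_summable hsum' ((Int.fract θ : ℝ) : UnitAddCircle)
  have hF : F ((Int.fract θ : ℝ) : UnitAddCircle) = Φ θ := by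
    change AddCircle.liftIco 1 0 Φ _ = _
    rw [AddCircle.liftIco_coe_apply (by simpa using And.intro (Int.fract_nonneg θ) (Int.fract_lt_one θ)),
      Int.fract, show θ - (⌊θ⌋ : ℝ) = θ - (⌊θ⌋ : ℤ) * (1 : ℝ) by simp, hper.sub_int_mul_eq]
  rw [hF] at step
  convert step using 1
  ext k
  rw [hcoef, smul_eq_mul, fourier_coe_apply]
  congr 1
  rw [Complex.exp_eq_exp_iff_exists_int]
  refine ⟨k * ⌊θ⌋, ?_⟩
  rw [Int.fract]
  push_cast
  ring

end HorocycleStripFourier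

end Literature.NumberTheory.LFunctions

end
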